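import Summits.BirchSwinnertonDyer.BirchSwinnertonDyer.Theorems.QuadraticBranchSignedControlPlusEtaNonsurjThetaFunctionalEquationLambda
import Summits.BirchSwinnertonDyer.BirchSwinnertonDyer.Theorems.QuadraticBranchSignedControlPlusEtaNonsurjMinusCoeffCongruence
import Summits.BirchSwinnertonDyer.Rank1Residual.X1.MuLambdaAlgebra
import Summits.BirchSwinnertonDyer.BirchSwinnertonDyer.Theorems.QuadraticBranchSignedControlPlusEtaLowerInclusionFunctionalEquationSqueezeAlgebra
import Literature.Barriers.BirchSwinnertonDyer.PAdicFunctionalEquationParity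
import HarnessLib

/-!
# Route `QuadraticBranchSignedControl` (rung K8, cell `bsd-potss`), residual crux `PlusEtaMainConjectureNonsurj`
# (stmt-BirchSwinnertonDyer-19606): THE FUNCTIONAL EQUATION ON THE QUADRATIC BRANCH, III — PARITY FROM A FUNCTIONAL
# EQUATION MODULO AN IDEAL: `ι F − w·U·F ∈ D·Λ`, `D ≡ T^{>λ}` (mod `p`) ⟹ `(−1)^{λ(F)} = w` (generic `Λ`-lemmas)
# (seat `bsd-potss-k8eta-c2` g27; kernel tool; sequel of `…ThetaFunctionalEquationLambda`)

WHY. Parts I–II (p759560, p759988) give the functional equation of the quadratic-branch Mazur–Tate elements in `Λ = ℤ_p⟦T⟧`: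
`ι Θ_n − w (1+T)^{s_N} Θ_n ∈ ω_n Λ`, `w = σ (−N | p)`; the sequel transports it to the Mazur–Tate limits and to every signed
branch function `L = L_p^±(V, η, X)` in the form `ι L − w·U·L ∈ T·ω^±_n·Λ` (`U(0) = 1`) for EVERY `n`. Such congruences — never an
exact equation `ι L = w u L` — are what the tree can prove without `p`-adic exponents `(1+T)^c`, `c ∈ ℤ_p`. THIS FILE proves that they
suffice for the PARITY of the `λ`-invariant: the generic mechanism of Greenberg's remark (LNM 1716, §5: a functional equation of sign
`w` forces `(−1)^{ord} = w`; tree: `Literature.Barriers.BirchSwinnertonDyer.eq_neg_one_pow_of_subst_eq` for EXACT equations over a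
domain) in CONGRUENCE form over `ℤ_p`, read on the `λ`-invariant `X1.MuLambda.lam` of the lineage's records.

MATHEMATICS. §8: let `ι F − w U F = D G` in `Λ`, `U(0) = 1`, `w = ±1`, `p` odd; if `F_j ∈ p^{k+1}ℤ_p` for `j < r`, `p^k ∥ F_r`, and
`D_i ∈ p^{k+1}ℤ_p` for `i ≤ r`, then comparing the coefficients of `T^r` modulo `p^{k+1}` — `(ι F)_r = Σ_d F_d (ι T)^d_r ≡ (−1)^r F_r`
(`ι T = −T + O(T²)`, `ord (ιT)^d ≥ d`), `(wUF)_r ≡ w F_r`, `(DG)_r ≡ 0` — gives `p ∣ ((−1)^r − w)·(F_r/p^k)`, so `(−1)^r = w`. §9: for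
`F ≠ 0` write `F = p^{μ} F₀` (`X1.MuLambda.pfree`), `λ(F) = ord_T(F₀ mod p)`; if `p ∤ D` then `μ(D G) = μ(G) ≥ μ` (the tree's
`mu_mul`), so the `p`-power cancels and `F₀` satisfies the same equation; §8 at `k = 0`, `r = λ(F)` gives `(−1)^{λ(F)} = w` whenever
`D_i ∈ pℤ_p` for `i ≤ λ(F)` — with NO hypothesis on `μ(F)`.

WHAT. §8 **`neg_one_pow_eq_of_invol_sub_eq_mul`** (with `(ιT)_1 = −1` = the tree's `Theorems.coeff_one_invSubOne`, k8eta-c1 g11); §9 `mu_eq_zero_of_not_C_dvd`,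
**`neg_one_pow_lam_eq_of_invol_sub_eq_mul`**.

HONEST FRAMING (cell `bsd-potss`; FULL-BSD rank ≤ 1 programme, HUMAN RULING D-0036/D-0074): TOOL THEOREMS ONLY (pure `Λ`-algebra) —
no definition, no named fact, no `sorry`, axioms standard; nothing about (A), (C1⁺_η), C-cc-1 or `BSD(W,p)` of any pair is claimed;
no stub of 19606 is proved; crux and route OPEN; nothing booked. `--supports stmt-BirchSwinnertonDyer-19606`.

References: [GreenbergLNM1716] §1 (functional equation), §5 (`λ^{anal}` odd ⟹ odd order); [Washington1997] §7.1 (μ, λ), §13.2 (ι);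
[MazurTateTeitelbaum1986Invent] §I.17. Tree: `IwasawaAlgebraInvolution.lean` (`invol`, `invSubOne`), `X1/MuLambdaAlgebra.lean`
(`mu`, `pfree`, `lam`, `red`, `mu_mul`), `Barriers/BirchSwinnertonDyer/PAdicFunctionalEquationParity.lean`
(`coeff_pow_self_of_constantCoeff_eq_zero`, `natCast_le_order_pow`).
-/

set_option autoImplicit false
set_option linter.dupNamespace false
noncomputable section

open scoped Classical

open Polynomial Literature.NumberTheory.EllipticCurves
open Literature.NumberTheory.EllipticCurves.IwasawaAlgebra
open Literature.Barriers.BirchSwinnertonDyer (coeff_pow_self_of_constantCoeff_eq_zero natCast_le_order_pow)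
open Summit.BirchSwinnertonDyer.Rank1Residual.X1.MuLambda (red mu pfree lam red_eq_zero_iff eq_C_pow_mu_mul_pfree
  red_pfree_ne_zero C_pow_mu_dvd le_mu_of_C_pow_dvd mu_mul C_pow_ne_zero)

namespace Summit.BirchSwinnertonDyer.BirchSwinnertonDyer.Theorems.EtaThetaFunctionalEquation

variable {p : ℕ} [hp : Fact p.Prime]

/-! ## §8 Parity from a functional equation modulo an ideal: the generic `Λ`-lemma -/

/-- **Parity from a functional equation modulo an ideal with `p`-small low coefficients** (the mechanism of
Greenberg's "`λ^{anal}` odd ⟹ odd order of vanishing", LNM 1716 §5, in congruence form). Let `F, U, D, G ∈ Λ = ℤ_p⟦T⟧`,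
`p` odd, `w = ±1`, with `ι F − w·U·F = D·G` (`ι : T ↦ (1+T)⁻¹ − 1`), `U(0) = 1`; suppose the coefficients of `F`
below degree `r` are divisible by `p^{k+1}`, the `r`-th is divisible by `p^k` exactly, and the coefficients of `D`
up to degree `r` are divisible by `p^{k+1}`. Then `(−1)^r = w` (compare the coefficients of `T^r` modulo `p^{k+1}`:
`(ι F)_r ≡ (−1)^r F_r`, `(wUF)_r ≡ w F_r`, `(DG)_r ≡ 0`, so `p ∣ ((−1)^r − w)`).
[cite: GreenbergLNM1716, §5 and §1 (functional equation)] [cite: Washington1997, §7.1 and §13.2] -/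
theorem neg_one_pow_eq_of_invol_sub_eq_mul (hp2 : p ≠ 2) {F U D G : PowerSeries ℤ_[p]} {w : ℤ}
    (hw : w = 1 ∨ w = -1) {r k : ℕ}
    (hlow : ∀ j < r, (p : ℤ_[p]) ^ (k + 1) ∣ PowerSeries.coeff j F)
    (hrk : (p : ℤ_[p]) ^ k ∣ PowerSeries.coeff r F) (hrk' : ¬ (p : ℤ_[p]) ^ (k + 1) ∣ PowerSeries.coeff r F)
    (hU : PowerSeries.constantCoeff U = 1) (hD : ∀ i ≤ r, (p : ℤ_[p]) ^ (k + 1) ∣ PowerSeries.coeff i D)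
    (hFE : invol p F - PowerSeries.C (w : ℤ_[p]) * U * F = D * G) :
    (-1 : ℤ) ^ r = w := by
  have hP : p.Prime := hp.out
  set P : ℤ_[p] := (p : ℤ_[p]) ^ (k + 1) with hPdef
  -- (1) `(ι F)_r ≡ (−1)^r F_r (mod P)`
  have h1 : P ∣ PowerSeries.coeff r (invol p F) - (-1) ^ r * PowerSeries.coeff r F := by
    have ha0 := constantCoeff_invSubOne p
    rw [invol_apply, PowerSeries.coeff_subst' (hasSubst_invSubOne p),
      finsum_eq_sum_of_support_subset _ (s := Finset.range (r + 1)) ?_]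
    · simp only [smul_eq_mul]
      rw [Finset.sum_range_succ, coeff_pow_self_of_constantCoeff_eq_zero ha0, coeff_one_invSubOne,
        show (∑ d ∈ Finset.range r, PowerSeries.coeff d F * PowerSeries.coeff r (invSubOne p ^ d)) +
          PowerSeries.coeff r F * (-1) ^ r - (-1) ^ r * PowerSeries.coeff r F =
          ∑ d ∈ Finset.range r, PowerSeries.coeff d F * PowerSeries.coeff r (invSubOne p ^ d) by ring]
      exact Finset.dvd_sum fun d hd ↦ Dvd.dvd.mul_right (hlow d (Finset.mem_range.mp hd)) _
    · intro d hd
      rw [Function.mem_support] at hd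
      rw [Finset.coe_range, Set.mem_Iio]
      by_contra hdr
      apply hd
      rw [PowerSeries.coeff_of_lt_order r (lt_of_lt_of_le (by exact_mod_cast (by omega : r < d))
        (natCast_le_order_pow ha0 d)), smul_zero]
  -- (2) `(w U F)_r ≡ w F_r (mod P)`
  have h2 : P ∣ PowerSeries.coeff r (PowerSeries.C (w : ℤ_[p]) * U * F) - (w : ℤ_[p]) * PowerSeries.coeff r F := by
    rw [mul_assoc, PowerSeries.coeff_C_mul, ← mul_sub, PowerSeries.coeff_mul]
    refine Dvd.dvd.mul_left ?_ _
    have hmem : ((0, r) : ℕ × ℕ) ∈ Finset.HasAntidiagonal.antidiagonal r := by simp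
    rw [← Finset.add_sum_erase _ _ hmem, PowerSeries.coeff_zero_eq_constantCoeff_apply, hU, one_mul,
      add_sub_cancel_left]
    refine Finset.dvd_sum fun x hx ↦ ?_
    rw [Finset.mem_erase, Finset.HasAntidiagonal.mem_antidiagonal] at hx
    have hx2 : x.2 < r := by
      rcases Nat.lt_or_ge x.2 r with h | h
      · exact h
      · exfalso; apply hx.1; ext <;> simp <;> omega
    exact Dvd.dvd.mul_left (hlow x.2 hx2) _
  -- (3) `(D G)_r ≡ 0 (mod P)`
  have h3 : P ∣ PowerSeries.coeff r (D * G) := by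
    rw [PowerSeries.coeff_mul]
    refine Finset.dvd_sum fun x hx ↦ ?_
    rw [Finset.HasAntidiagonal.mem_antidiagonal] at hx
    exact Dvd.dvd.mul_right (hD x.1 (by omega)) _
  -- (4) `P ∣ ((−1)^r − w) F_r`
  have hAB := congr_arg (PowerSeries.coeff r) hFE
  rw [map_sub] at hAB
  have h4 : P ∣ ((-1 : ℤ_[p]) ^ r - w) * PowerSeries.coeff r F := by
    have e : ((-1 : ℤ_[p]) ^ r - w) * PowerSeries.coeff r F =
        -(PowerSeries.coeff r (invol p F) - (-1) ^ r * PowerSeries.coeff r F) +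
        (PowerSeries.coeff r (PowerSeries.C (w : ℤ_[p]) * U * F) - (w : ℤ_[p]) * PowerSeries.coeff r F) +
        (PowerSeries.coeff r (invol p F) - PowerSeries.coeff r (PowerSeries.C (w : ℤ_[p]) * U * F)) := by ring
    rw [e, hAB]
    exact (h1.neg_right.add h2).add h3
  -- (5) `p ∣ (−1)^r − w`, hence equality since `p ≠ 2`
  obtain ⟨c, hc⟩ := hrk
  have hpc : ¬ (p : ℤ_[p]) ∣ c := by
    rintro ⟨c', rfl⟩
    exact hrk' ⟨c', by rw [hc, hPdef, pow_succ]; ring⟩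
  rw [hc, hPdef, pow_succ, mul_left_comm] at h4
  have h5 : (p : ℤ_[p]) ∣ ((-1 : ℤ_[p]) ^ r - w) * c :=
    (mul_dvd_mul_iff_left (pow_ne_zero k (by exact_mod_cast hP.ne_zero))).mp h4
  have h6 : (p : ℤ_[p]) ∣ ((((-1) ^ r - w : ℤ)) : ℤ_[p]) := by
    push_cast
    exact ((PadicInt.irreducible_p.prime).dvd_or_dvd h5).resolve_right hpc
  have h7 : (p : ℤ) ∣ (-1) ^ r - w := (PadicInt.norm_int_lt_one_iff_dvd _).mp (PadicInt.norm_lt_one_iff_dvd _ |>.mpr h6)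
  have h2' : ¬ (p : ℤ) ∣ 2 := by
    intro h
    have h' : p ∣ 2 := by exact_mod_cast h
    exact hp2 ((Nat.prime_dvd_prime_iff_eq hP Nat.prime_two).mp h')
  rcases neg_one_pow_eq_or ℤ r with h | h <;> rcases hw with rfl | rfl
  · exact h
  · exfalso; rw [h] at h7; norm_num at h7; exact h2' h7
  · exfalso; rw [h] at h7; norm_num at h7; exact h2' h7
  · exact h

/-! ## §9 The `λ`-invariant has the parity of the sign -/

/-- A power series not divisible by `p` has `μ = 0`. [folklore] -/
theorem mu_eq_zero_of_not_C_dvd {D : PowerSeries ℤ_[p]} (hD : ¬ PowerSeries.C (p : ℤ_[p]) ∣ D) : mu D = 0 := by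
  apply Nat.eq_zero_of_le_zero
  refine csSup_le ⟨0, by simp⟩ fun n hn ↦ ?_
  rcases Nat.eq_zero_or_pos n with rfl | hpos
  · exact le_rfl
  · exfalso; apply hD
    obtain ⟨E, hE⟩ := hn
    refine ⟨PowerSeries.C ((p : ℤ_[p]) ^ (n - 1)) * E, ?_⟩
    rw [hE, ← mul_assoc, ← map_mul, ← pow_succ', Nat.sub_add_cancel hpos]

/-- **`(−1)^{λ(F)} = w` for every nonzero `F ∈ Λ` with a functional equation `ι F − w U F ∈ D Λ`**, `U(0) = 1`,
`w = ±1`, `p` odd, where `D` is NOT divisible by `p` but its coefficients up to degree `λ(F)` are (e.g.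
`D = T·ω^±_n` or `ω_n`, `≡ T^{deg} (mod p)`, of degree `> λ(F)`). No hypothesis on `μ(F)`: writing `F = p^μ F₀`,
the `p`-power passes through the equation (`μ(D G) = μ(G)` as `μ(D) = 0`), and `neg_one_pow_eq_of_invol_sub_eq_mul`
applies to `F₀` at `r = λ(F) = ord_T(F₀ mod p)`. [cite: GreenbergLNM1716, §5] [cite: Washington1997, §7.1 and §13.2] -/
theorem neg_one_pow_lam_eq_of_invol_sub_eq_mul (hp2 : p ≠ 2) {F U D G : PowerSeries ℤ_[p]} (hF : F ≠ 0)
    {w : ℤ} (hw : w = 1 ∨ w = -1) (hU : PowerSeries.constantCoeff U = 1)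
    (hD : ∀ i ≤ lam F, (p : ℤ_[p]) ∣ PowerSeries.coeff i D) (hDp : ¬ PowerSeries.C (p : ℤ_[p]) ∣ D)
    (hFE : invol p F - PowerSeries.C (w : ℤ_[p]) * U * F = D * G) :
    (-1 : ℤ) ^ lam F = w := by
  have hP : p.Prime := hp.out
  set μ := mu F with hμ
  set F₀ := pfree F with hF₀
  have hFF : F = PowerSeries.C ((p : ℤ_[p]) ^ μ) * F₀ := eq_C_pow_mu_mul_pfree F
  have hred : red F₀ ≠ 0 := red_pfree_ne_zero hF
  -- the functional equation for `F₀`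
  have hFE' : PowerSeries.C ((p : ℤ_[p]) ^ μ) * (invol p F₀ - PowerSeries.C (w : ℤ_[p]) * U * F₀) = D * G := by
    rw [← hFE, hFF, map_mul, invol_C]; ring
  have hG : PowerSeries.C ((p : ℤ_[p]) ^ μ) ∣ G := by
    by_cases hG0 : G = 0
    · rw [hG0]; exact dvd_zero _
    · have hD0 : D ≠ 0 := fun h ↦ hDp (h ▸ dvd_zero _)
      have hDG : D * G ≠ 0 := mul_ne_zero hD0 hG0
      have hle : μ ≤ mu (D * G) := le_mu_of_C_pow_dvd hDG ⟨_, hFE'.symm⟩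
      rw [mu_mul hD0 hG0, mu_eq_zero_of_not_C_dvd hDp, zero_add] at hle
      exact (map_dvd (PowerSeries.C (R := ℤ_[p])) (pow_dvd_pow (p : ℤ_[p]) hle)).trans (C_pow_mu_dvd hG0)
  obtain ⟨G₀, hG₀⟩ := hG
  have hFE0 : invol p F₀ - PowerSeries.C (w : ℤ_[p]) * U * F₀ = D * G₀ :=
    mul_left_cancel₀ (C_pow_ne_zero μ) (by rw [hFE', hG₀]; ring)
  -- `r = λ(F) = ord_T (F₀ mod p)`
  have hne : (red F₀).order ≠ ⊤ := fun h ↦ hred (PowerSeries.order_eq_top.mp h)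
  have hord : (red F₀).order = (lam F : ℕ) := by
    show (red F₀).order = ((red (pfree F)).order.toNat : ℕ)
    rw [← hF₀, ENat.coe_toNat hne]
  have hdvd_iff : ∀ x : ℤ_[p], (p : ℤ_[p]) ∣ x ↔ IsLocalRing.residue ℤ_[p] x = 0 := by
    intro x
    rw [IsLocalRing.residue_eq_zero_iff, PadicInt.maximalIdeal_eq_span_p, Ideal.mem_span_singleton]
  have hlow : ∀ j < lam F, (p : ℤ_[p]) ^ (0 + 1) ∣ PowerSeries.coeff j F₀ := by
    intro j hj
    rw [zero_add, pow_one, hdvd_iff, ← PowerSeries.coeff_map]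
    exact PowerSeries.coeff_of_lt_order j (by rw [hord]; exact_mod_cast hj)
  have htop : ¬ (p : ℤ_[p]) ^ (0 + 1) ∣ PowerSeries.coeff (lam F) F₀ := by
    rw [zero_add, pow_one, hdvd_iff, ← PowerSeries.coeff_map]
    exact (PowerSeries.order_eq_nat.mp hord).1
  exact neg_one_pow_eq_of_invol_sub_eq_mul hp2 hw (k := 0) hlow (by rw [pow_zero]; exact one_dvd _) htop hU
    (fun i hi ↦ by rw [zero_add, pow_one]; exact hD i hi) hFE0

end Summit.BirchSwinnertonDyer.BirchSwinnertonDyer.Theorems.EtaThetaFunctionalEquation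

end
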